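import Mathlib
import Literature.Computability.AlgebraicComplexity.GroupTheoreticMatMul
import Literature.Barriers.MatrixMultiplication.TricoloredSumFreeBarrier

/-!
# The sharp Neumann-type packing inequality for STPP families (census form)

Support file for route `MatrixMultiplication/GroupTheoreticSTPP`, crux `stmt-MatrixMultiplication-0597`,
cell `mm-stpp` (D-0046); companion of `GroupTheoreticSTPPCThesisNeumannPacking.lean` (Theorem A,
`STPPNeumannPacking.stpp_neumann_packing`).  That file states the inequality in the RELAXED form
`∑ |C i| (|A i| + |B i|) ≤ |G| + m` (`m ≥ |C i|`); its double-counting proof actually gives the SHARP form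
recorded here for the census predicate `IsSTPP` (abelian host), which is what the planner's all-shapes
arithmetic sieve (CENSUS-PLAN §3 U11/U12) should use:

* `isSTPP_neumann_packing_sharp` — with `q = ∑ |A i||B i|`, `r = ∑ |B i||C i|`, `p = ∑ |C i||A i|` and
  `V = ∑ |A i||B i||C i|`:  `q · (r + p) ≤ V + q · |H|`, i.e. `q (p + r − |H|) ≤ V`
  (and the rotations `…₂`, `…₃` obtained from `IsSTPP.rotate`);
* `no_isSTPP_444x3_222_order100` — the instance that settles the sieve's question Q3.7′: no STPP family
  of shapes `{(4,4,4),(4,4,4),(4,4,4),(2,2,2)}` in an abelian group of order `100`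
  (`p = q = r = 52`, `V = 200`, `52 · 4 = 208 > 200`), although the relaxed form allows it (`104 ≤ 104`).

Proof: `Q = ⋃(B_i − A_i)`, `R = ⋃(C_i − B_i)`, `P' = ⋃(C_i − A_i)` have `q, r, p` elements (two-equal-index
patterns of the STPP); of the `q·r` pairs, those whose sum lies in `P'` inject into `⨆ A i × B i × C i`
(`V` of them at most), the others into `Q-preimages × (H ∖ P')` (`q (|H| − p)` at most).

WHAT THIS IS NOT: no `ω` statement; a necessary condition on shape multisets only.
-/

-- single-conjunct summit: the mandated namespace repeats `MatrixMultiplication`.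
set_option linter.dupNamespace false

namespace Summit.MatrixMultiplication.MatrixMultiplication.Theorems

namespace STPPNeumannPackingSharp

open Finset Literature.Computability.AlgebraicComplexity

variable {H : Type*} [AddCommGroup H] [Fintype H] [DecidableEq H] {N : ℕ} {A B C : Fin N → Finset H}

omit [Fintype H] [DecidableEq H] in
/-- `(i, a, b) ↦ −a + b` is injective on `⨆ i, A i × B i` (pattern with two equal indices; needs the
`C i` non-empty). [cite: BlasiakChurchCohnGrochowNaslundSawinUmans2017, §2] -/
theorem negAdd_injOn_AB (h : IsSTPP A B C) (hC : ∀ i, (C i).Nonempty) :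
    Set.InjOn (fun z : Σ _ : Fin N, H × H => -z.2.1 + z.2.2)
      ↑(univ.sigma fun i => A i ×ˢ B i : Finset (Σ _ : Fin N, H × H)) := by
  rintro ⟨i₁, a₁, b₁⟩ h₁ ⟨i₂, a₂, b₂⟩ h₂ (he : -a₁ + b₁ = -a₂ + b₂)
  simp only [coe_sigma, Set.mem_sigma_iff, coe_univ, Set.mem_univ, true_and, coe_product,
    Set.mem_prod, mem_coe] at h₁ h₂
  obtain ⟨c, hc⟩ := hC i₂
  have key : (a₁ - a₂) + (b₂ - b₁) + (c - c) = 0 := by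
    have : b₁ = a₁ + (-a₂ + b₂) := by rw [← he]; abel
    rw [this]; abel
  obtain ⟨hij, -, hs, ht, -⟩ := h i₁ i₂ i₂ a₂ h₂.1 a₁ h₁.1 b₁ h₁.2 b₂ h₂.2 c hc c hc key
  subst hij; subst hs; subst ht; rfl

omit [Fintype H] [DecidableEq H] in
/-- `(j, b, c) ↦ −b + c` is injective on `⨆ j, B j × C j` (needs the `A j` non-empty).
[cite: BlasiakChurchCohnGrochowNaslundSawinUmans2017, §2] -/
theorem negAdd_injOn_BC (h : IsSTPP A B C) (hA : ∀ i, (A i).Nonempty) :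
    Set.InjOn (fun z : Σ _ : Fin N, H × H => -z.2.1 + z.2.2)
      ↑(univ.sigma fun j => B j ×ˢ C j : Finset (Σ _ : Fin N, H × H)) := by
  rintro ⟨j₁, b₁, c₁⟩ h₁ ⟨j₂, b₂, c₂⟩ h₂ (he : -b₁ + c₁ = -b₂ + c₂)
  simp only [coe_sigma, Set.mem_sigma_iff, coe_univ, Set.mem_univ, true_and, coe_product,
    Set.mem_prod, mem_coe] at h₁ h₂
  obtain ⟨a, ha⟩ := hA j₂
  have key : (a - a) + (b₁ - b₂) + (c₂ - c₁) = 0 := by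
    have : c₁ = b₁ + (-b₂ + c₂) := by rw [← he]; abel
    rw [this]; abel
  obtain ⟨hij, -, -, ht, hu⟩ := h j₂ j₁ j₂ a ha a ha b₂ h₂.1 b₁ h₁.1 c₁ h₁.2 c₂ h₂.2 key
  subst hij; subst ht; subst hu; rfl

omit [Fintype H] [DecidableEq H] in
/-- `(k, c, a) ↦ −a + c` is injective on `⨆ k, C k × A k` (needs the `B k` non-empty).
[cite: BlasiakChurchCohnGrochowNaslundSawinUmans2017, §2] -/
theorem negAdd_injOn_CA (h : IsSTPP A B C) (hB : ∀ i, (B i).Nonempty) :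
    Set.InjOn (fun z : Σ _ : Fin N, H × H => -z.2.2 + z.2.1)
      ↑(univ.sigma fun k => C k ×ˢ A k : Finset (Σ _ : Fin N, H × H)) := by
  rintro ⟨k₁, c₁, a₁⟩ h₁ ⟨k₂, c₂, a₂⟩ h₂ (he : -a₁ + c₁ = -a₂ + c₂)
  simp only [coe_sigma, Set.mem_sigma_iff, coe_univ, Set.mem_univ, true_and, coe_product,
    Set.mem_prod, mem_coe] at h₁ h₂
  obtain ⟨b, hb⟩ := hB k₂
  have key : (a₂ - a₁) + (b - b) + (c₁ - c₂) = 0 := by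
    have : c₁ = a₁ + (-a₂ + c₂) := by rw [← he]; abel
    rw [this]; abel
  obtain ⟨-, hjk, hs, -, hu⟩ := h k₂ k₂ k₁ a₁ h₁.2 a₂ h₂.2 b hb b hb c₂ h₂.1 c₁ h₁.1 key
  subst hjk; subst hs; subst hu; rfl

omit [AddCommGroup H] [Fintype H] [DecidableEq H] in
/-- `|⨆ i, X i × Y i| = ∑ i, |X i| |Y i|`. [folklore] -/
theorem card_sigma_product' (X Y : Fin N → Finset H) :
    (univ.sigma fun i => X i ×ˢ Y i).card = ∑ i, (X i).card * (Y i).card := by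
  rw [card_sigma]; simp only [card_product]

/-- **Theorem A, sharp census form.** For an `IsSTPP` family in a finite abelian group `H` with all `A i`,
`B i` non-empty, with `q = ∑ |A i||B i|`, `r = ∑ |B i||C i|`, `p = ∑ |C i||A i|`, `V = ∑ |A i||B i||C i|`:
`q · (r + p) ≤ V + q · |H|`. [original] -/
theorem isSTPP_neumann_packing_sharp (h : IsSTPP A B C) (hA : ∀ i, (A i).Nonempty)
    (hB : ∀ i, (B i).Nonempty) :
    (∑ i, (A i).card * (B i).card) * ((∑ i, (B i).card * (C i).card) + ∑ i, (C i).card * (A i).card)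
      ≤ (∑ i, (A i).card * (B i).card * (C i).card)
        + (∑ i, (A i).card * (B i).card) * Fintype.card H := by
  classical
  set QD : Finset (Σ _ : Fin N, H × H) := univ.sigma fun i => A i ×ˢ B i with hQD
  set RD : Finset (Σ _ : Fin N, H × H) := univ.sigma fun j => B j ×ˢ C j with hRD
  set PD : Finset (Σ _ : Fin N, H × H) := univ.sigma fun k => C k ×ˢ A k with hPD
  set nq : (Σ _ : Fin N, H × H) → H := fun z => -z.2.1 + z.2.2 with hnq
  set P' : Finset H := PD.image (fun z => -z.2.2 + z.2.1) with hPdef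
  have hP'card : P'.card = PD.card := by
    rw [hPdef]; exact card_image_of_injOn (by rw [hPD]; exact negAdd_injOn_CA h hB)
  set X := QD ×ˢ RD with hX
  set φ : (Σ _ : Fin N, H × H) × (Σ _ : Fin N, H × H) → H := fun x => nq x.1 + nq x.2 with hφ
  set X₁ := X.filter fun x => φ x ∈ P' with hX₁
  set X₂ := X.filter fun x => φ x ∉ P' with hX₂
  have hsplit : X₁.card + X₂.card = X.card := card_filter_add_card_filter_not _
  -- (1) `X₁` injects into `⨆ i, (A i × B i) × C i`
  set T : Finset (Σ _ : Fin N, (H × H) × H) := univ.sigma fun i => (A i ×ˢ B i) ×ˢ C i with hT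
  -- the CKSU relation read off from `φ x ∈ P'`
  have hrel : ∀ x ∈ X₁, ∃ c ∈ C x.1.1, x.1.1 = x.2.1 ∧ x.1.2.2 = x.2.2.1 ∧ x.2.2.2 = c := by
    intro x hx
    rw [hX₁, mem_filter, hX, mem_product, hQD, hRD] at hx
    obtain ⟨⟨hq, hr⟩, hφx⟩ := hx
    rw [hPdef, mem_image] at hφx
    obtain ⟨⟨k, c, a⟩, hz, hzφ⟩ := hφx
    rw [hPD] at hz
    simp only [mem_sigma, mem_univ, true_and, mem_product] at hq hr hz
    obtain ⟨⟨i, a₁, b₁⟩, ⟨j, b₂, c₂⟩⟩ := x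
    simp only at hq hr hzφ ⊢
    have key : (a₁ - a) + (b₂ - b₁) + (c - c₂) = 0 := by
      have : c = a + ((-a₁ + b₁) + (-b₂ + c₂)) := by
        have h' : -a + c = (-a₁ + b₁) + (-b₂ + c₂) := by simpa only [hnq, hφ] using hzφ
        rw [← h']; abel
      rw [this]; abel
    obtain ⟨hij, hjk, hs, ht, hu⟩ := h i j k a hz.2 a₁ hq.1 b₁ hq.2 b₂ hr.1 c₂ hr.2 c hz.1 key
    subst hij; subst hjk
    exact ⟨c, hz.1, rfl, ht, hu⟩
  have hX₁ : X₁.card ≤ T.card := by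
    refine card_le_card_of_injOn (fun x => ⟨x.1.1, (x.1.2, x.2.2.2)⟩) ?_ ?_
    · intro x hx
      rw [mem_coe] at hx
      obtain ⟨c, hc, h1, -, h3⟩ := hrel x hx
      rw [hX₁, mem_filter, hX, mem_product, hQD] at hx
      simp only [mem_sigma, mem_univ, true_and, mem_product] at hx
      simp only [hT, coe_sigma, Set.mem_sigma_iff, coe_univ, Set.mem_univ, true_and, coe_product,
        Set.mem_prod, mem_coe]
      exact ⟨⟨hx.1.1.1, hx.1.1.2⟩, by rw [h3]; exact hc⟩
    · intro x hx y hy hxy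
      rw [mem_coe] at hx hy
      obtain ⟨-, -, hij, hbb, -⟩ := hrel x hx
      obtain ⟨-, -, hij', hbb', -⟩ := hrel y hy
      simp only [Sigma.mk.injEq] at hxy
      obtain ⟨hi, hrest⟩ := hxy
      obtain ⟨⟨i, a, b⟩, ⟨j, b', c⟩⟩ := x
      obtain ⟨⟨i', a₁, b₁⟩, ⟨j', b₁', c₁⟩⟩ := y
      simp only at hi hij hij' hbb hbb' hrest ⊢
      subst hi
      simp only [heq_eq_eq, Prod.mk.injEq] at hrest
      obtain ⟨⟨rfl, rfl⟩, rfl⟩ := hrest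
      subst hij; subst hij'; subst hbb; subst hbb'
      rfl
  have hT_card : T.card = ∑ i, (A i).card * (B i).card * (C i).card := by
    rw [hT, card_sigma]; simp only [card_product]
  -- (2) `X₂` injects into `QD × (univ \ P')`
  have hX₂ : X₂.card ≤ (QD ×ˢ (univ \ P')).card := by
    refine card_le_card_of_injOn (fun x => (x.1, φ x)) ?_ ?_
    · intro x hx
      rw [hX₂, mem_coe, mem_filter, hX, mem_product] at hx
      simp only [coe_product, coe_sdiff, coe_univ, Set.mem_prod, mem_coe, Set.mem_sdiff,
        Set.mem_univ, true_and]
      exact ⟨hx.1.1, hx.2⟩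
    · intro x hx y hy hxy
      rw [hX₂, mem_coe, mem_filter, hX, mem_product] at hx hy
      simp only [Prod.mk.injEq] at hxy
      obtain ⟨h1, h2⟩ := hxy
      have hq2 : nq x.2 = nq y.2 := by
        have : nq x.1 + nq x.2 = nq y.1 + nq y.2 := by simpa only [hφ] using h2
        rw [h1] at this
        exact add_left_cancel this
      have := negAdd_injOn_BC h hA (by rw [← hRD]; exact hx.1.2) (by rw [← hRD]; exact hy.1.2)
        (by simpa only [hnq] using hq2)
      exact Prod.ext h1 this
  have hX₂' : X₂.card ≤ QD.card * (Fintype.card H - P'.card) := by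
    calc X₂.card ≤ (QD ×ˢ (univ \ P')).card := hX₂
      _ = QD.card * (Fintype.card H - P'.card) := by rw [card_product, card_univ_sdiff]
  -- assemble (no division needed)
  have hXcard : X.card = QD.card * RD.card := by rw [hX, card_product]
  have hQ : QD.card = ∑ i, (A i).card * (B i).card := by rw [hQD, card_sigma_product']
  have hR : RD.card = ∑ i, (B i).card * (C i).card := by rw [hRD, card_sigma_product']
  have hP : P'.card = ∑ i, (C i).card * (A i).card := by rw [hP'card, hPD, card_sigma_product']
  have hPle : P'.card ≤ Fintype.card H := card_le_univ _
  have hmain : QD.card * RD.card ≤ T.card + QD.card * (Fintype.card H - P'.card) := by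
    rw [← hXcard, ← hsplit]; exact Nat.add_le_add hX₁ hX₂'
  rw [← hQ, ← hR, ← hP, ← hT_card]
  have : QD.card * (Fintype.card H - P'.card) + QD.card * P'.card = QD.card * Fintype.card H := by
    rw [← mul_add, Nat.sub_add_cancel hPle]
  nlinarith [hmain, this]

/-- Sharp form, second rotation (`r · (p + q) ≤ V + r |H|`). [original] -/
theorem isSTPP_neumann_packing_sharp₂ (h : IsSTPP A B C) (hB : ∀ i, (B i).Nonempty)
    (hC : ∀ i, (C i).Nonempty) :
    (∑ i, (B i).card * (C i).card) * ((∑ i, (C i).card * (A i).card) + ∑ i, (A i).card * (B i).card)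
      ≤ (∑ i, (B i).card * (C i).card * (A i).card)
        + (∑ i, (B i).card * (C i).card) * Fintype.card H :=
  isSTPP_neumann_packing_sharp h.rotate hB hC

/-- Sharp form, third rotation (`p · (q + r) ≤ V + p |H|`). [original] -/
theorem isSTPP_neumann_packing_sharp₃ (h : IsSTPP A B C) (hC : ∀ i, (C i).Nonempty)
    (hA : ∀ i, (A i).Nonempty) :
    (∑ i, (C i).card * (A i).card) * ((∑ i, (A i).card * (B i).card) + ∑ i, (B i).card * (C i).card)
      ≤ (∑ i, (C i).card * (A i).card * (B i).card)
        + (∑ i, (C i).card * (A i).card) * Fintype.card H :=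
  isSTPP_neumann_packing_sharp h.rotate.rotate hC hA

/-- **Q3.7′ by theorem.** No `IsSTPP` family with shapes `(4,4,4), (4,4,4), (4,4,4), (2,2,2)` in an abelian
group of order `100`: `q = r = p = 52`, `V = 200`, and `52 · 104 = 5408 > 200 + 5200`. (The planner's
sieve admitted this multiset under the relaxed bound `∑ c_i(a_i+b_i) = 104 ≤ |H| + max c_i = 104`.)
[original] -/
theorem no_isSTPP_444x3_222_order100 (hH : Fintype.card H = 100) (A B C : Fin 4 → Finset H)
    (hA : ∀ i, (A i).card = ![4, 4, 4, 2] i) (hB : ∀ i, (B i).card = ![4, 4, 4, 2] i)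
    (hC : ∀ i, (C i).card = ![4, 4, 4, 2] i) : ¬ IsSTPP A B C := by
  intro h
  have hAne : ∀ i, (A i).Nonempty := fun i => card_pos.1 (by rw [hA i]; fin_cases i <;> simp)
  have hBne : ∀ i, (B i).Nonempty := fun i => card_pos.1 (by rw [hB i]; fin_cases i <;> simp)
  have := isSTPP_neumann_packing_sharp h hAne hBne
  simp only [hA, hB, hC, Fin.sum_univ_four, hH] at this
  simp at this

end STPPNeumannPackingSharp

end Summit.MatrixMultiplication.MatrixMultiplication.Theorems
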